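import Mathlib.Analysis.SpecialFunctions.Pow.Asymptotics
import Mathlib.Analysis.SpecialFunctions.Pow.Real
import Mathlib.Analysis.Complex.Basic
import Mathlib.Data.Nat.Log
import Summits.MatrixMultiplication.Statement
import Summits.MatrixMultiplication.MatrixMultiplication.Theorems.AsymptoticSpectrumMonotone
import Summits.MatrixMultiplication.MatrixMultiplication.Theorems.AsymptoticSpectrumOmegaGeTwo

/-!
# MatrixMultiplication / AsymptoticSpectrum — assembly `X_A ⇒ ω(ℂ) = 2`

Route `MatrixMultiplication/AsymptoticSpectrum`, item `stmt-MatrixMultiplication-0580` (rank 1):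
if for every `ε > 0`, `R(⟨2^N,2^N,2^N⟩) = O(4^{(1+ε)N})` over `ℂ` (asymptotic rank of `⟨2,2,2⟩`
is `4`), then `ω(ℂ) = 2`. Interpolation `2^N ≤ n < 2^{N+1}` by monotonicity (`Monotone.lean`),
`ω ≥ 2` and `BddBelow` from the flattening bound (`OmegaGeTwo.lean`); the rest is
`Real.rpow` bookkeeping (Bläser 2013, §5).
-/

noncomputable section

open Filter Asymptotics

namespace Literature.CplxAlg

/-- From the `2^N`-subsequence bound to admissibility of `2 + δ`: if
`R(⟨2^N,2^N,2^N⟩) = O(4^{(1+δ/2)N})` then `2 + δ ∈ admissibleExponents K` (any field; monotonicity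
in `n`). [cite: Blaser2013, §5] -/
theorem mem_admissibleExponents_of_pow_two (K : Type) [Field K] {δ : ℝ} (hδ : 0 < δ)
    (h : (fun N : ℕ => (Literature.Computability.AlgebraicComplexity.tensorRank (Literature.Computability.AlgebraicComplexity.matMulTensor K (2 ^ N) (2 ^ N) (2 ^ N)) : ℝ)) =O[atTop]
      fun N : ℕ => (4 : ℝ) ^ ((1 + δ / 2) * N)) :
    (2 + δ) ∈ Literature.Computability.AlgebraicComplexity.admissibleExponents K := by
  obtain ⟨C, hC⟩ := h.bound
  obtain ⟨N₀, hN₀⟩ := eventually_atTop.1 hC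
  refine IsBigO.of_bound (C * (2 : ℝ) ^ (2 + δ)) ?_
  filter_upwards [eventually_ge_atTop (2 ^ N₀), eventually_ge_atTop 1] with n hn hn1
  set N := Nat.log 2 n + 1 with hN
  have hlt : n < 2 ^ N := Nat.lt_pow_succ_log_self (by norm_num) n
  have hle : 2 ^ N ≤ 2 * n := by
    rw [hN, pow_succ, mul_comm]
    exact Nat.mul_le_mul_left 2 (Nat.pow_log_le_self 2 (by omega))
  have hNN : N₀ ≤ N := by
    have : 2 ^ N₀ < 2 ^ N := lt_of_le_of_lt hn hlt
    exact ((Nat.pow_lt_pow_iff_right (by norm_num)).1 this).le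
  have hmono := tensorRank_matMulTensor_mono K hlt.le
  have hB := hN₀ N hNN
  have h4pos : (0 : ℝ) < (4 : ℝ) ^ ((1 + δ / 2) * N) := Real.rpow_pos_of_pos (by norm_num) _
  rw [Real.norm_of_nonneg (Nat.cast_nonneg _), Real.norm_of_nonneg h4pos.le] at hB
  have hCnn : 0 ≤ C := by
    have h1 : (0 : ℝ) ≤ C * (4 : ℝ) ^ ((1 + δ / 2) * N) := (Nat.cast_nonneg _).trans hB
    nlinarith
  have h4 : (4 : ℝ) ^ ((1 + δ / 2) * (N : ℝ)) = (((2 ^ N : ℕ) : ℝ)) ^ (2 + δ) := by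
    rw [show (4 : ℝ) = (2 : ℝ) ^ (2 : ℝ) by norm_num, ← Real.rpow_mul (by norm_num), Nat.cast_pow,
      Nat.cast_ofNat, ← Real.rpow_natCast, ← Real.rpow_mul (by norm_num)]
    congr 1
    ring
  have hnpos : (0 : ℝ) < n := by exact_mod_cast hn1
  rw [Real.norm_of_nonneg (Nat.cast_nonneg _),
    Real.norm_of_nonneg (Real.rpow_nonneg hnpos.le _)]
  calc (Literature.Computability.AlgebraicComplexity.tensorRank (Literature.Computability.AlgebraicComplexity.matMulTensor K n n n) : ℝ)
      ≤ (Literature.Computability.AlgebraicComplexity.tensorRank (Literature.Computability.AlgebraicComplexity.matMulTensor K (2 ^ N) (2 ^ N) (2 ^ N)) : ℝ) := by exact_mod_cast hmono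
    _ ≤ C * (4 : ℝ) ^ ((1 + δ / 2) * N) := hB
    _ = C * (((2 ^ N : ℕ) : ℝ)) ^ (2 + δ) := by rw [h4]
    _ ≤ C * ((2 * n : ℕ) : ℝ) ^ (2 + δ) := by
        gcongr
    _ = C * (2 : ℝ) ^ (2 + δ) * (n : ℝ) ^ (2 + δ) := by
        rw [Nat.cast_mul, Nat.cast_ofNat, Real.mul_rpow (by norm_num) hnpos.le, mul_assoc]

end Literature.CplxAlg

open Literature.Computability.AlgebraicComplexity in
/-- Settles `stmt-MatrixMultiplication-0580` (assembly of route `AsymptoticSpectrum`): the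
asymptotic-rank form `X_A` of `ω = 2` implies `MatrixMultiplication` (`ω(ℂ) = 2`).
[cite: Blaser2013, §5] -/
theorem Literature.CplxAlg.asymptoticRank_two_imp_matrixMultiplication :
    (∀ ε : ℝ, 0 < ε → (fun N : ℕ =>
        (Literature.Computability.AlgebraicComplexity.tensorRank (Literature.Computability.AlgebraicComplexity.matMulTensor ℂ (2 ^ N) (2 ^ N) (2 ^ N)) : ℝ))
          =O[Filter.atTop] fun N : ℕ => (4 : ℝ) ^ ((1 + ε) * N)) → _root_.MatrixMultiplication := by
  intro hX
  show omega ℂ = 2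
  refine le_antisymm ?_ (two_le_omega ℂ)
  -- ω ≤ 2 + δ for every δ > 0
  refine le_of_forall_pos_lt_add fun δ hδ => ?_
  have hmem : (2 + δ / 2) ∈ admissibleExponents ℂ :=
    mem_admissibleExponents_of_pow_two ℂ (by positivity) (hX (δ / 2 / 2) (by positivity))
  calc omega ℂ ≤ 2 + δ / 2 := csInf_le (bddBelow_admissibleExponents ℂ) hmem
    _ < 2 + δ := by linarith
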